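import Summits.BirchSwinnertonDyer.BirchSwinnertonDyer.Theorems.ResidualThetaTransportAtTwoSignedMuVanishingAtTwoPlusManinIndex
import Summits.BirchSwinnertonDyer.BirchSwinnertonDyer.Theorems.ResidualThetaTransportAtTwoResidualThetaMainConjectureAtTwoLayerMuReading
import Literature.NumberTheory.EllipticCurves.AgasheRibetStein2006.ManinConstantOptimalCurves
import HarnessLib

/-!
# Route `ResidualThetaTransportAtTwo`, crux Kμ⁺ `SignedMuVanishingAtTwoPlus` (stmt-BirchSwinnertonDyer-20689):
# the CREMONA DOOR to the period unit — for conductor `≤ 130000` (the whole rung habitat, `N < 10⁴`) the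
# stub `stub_periodUnitAtTwo` at `W` follows from Cremona's PUBLISHED computation `c₀ = 1`
# (Agashe–Ribet–Stein 2006 Thm. 2.6) instead of Abbes–Ullmo; with ONE Mazur–Tate layer it certifies the
# analytic child at `W`

Cell `bsd-wall`, width seat `bsd-wall-rtt-p4-w2` on the lead line `birth` (v4; stubs `stub_periodUnitAtTwo` [PRINT:
Abbes–Ullmo Thm. A] and `stub_flatMuZeroAtTwo` [research]). THEOREMS ONLY (no `def`, no named fact, no `sorry`);
route-independent helper `--supports` the crux; nothing about any curve is asserted and BSD is not proved by this.
Inputs BY NAME: this seat's p580150 `…ManinIndex` (`exists_periodUnit_of_forall_optimal_not_dvd_maninConstant`: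
`Ω(W) = u Ω⁺_f`, `‖u‖_p = 1`, as soon as the Manin constant of every lattice-optimal datum at the level is prime to `p`;
`exists_optimalDatum_forall_mu_eq_iff_mu_eq_padicValInt_maninConstant`), the tree's named fact
`AgasheRibetStein2006.cremona_abs_maninConstant_eq_one_of_level_le` (statement only: "If `E` is an optimal elliptic
curve over `ℚ` with conductor at most `130000`, then `c_E = 1`", Thm. 2.6 = Cremona's appendix Thm. 5.2) with its
corollary `not_dvd_maninConstant_of_level_le`, the lead's p567665 `…AnalyticAtW` and the sibling crux's layer reading
`ResidualThetaLayer.mu_eq_zero_of_supNorm_mazurTateElement_two_eq_one` (rtt-p2).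

* `exists_periodUnit_of_cremona_of_level_le` — ANY prime `p`, `E[p]` irreducible, newform `f` at level `N ≤ 130000`:
  `Ω(W) = u · Ω⁺_f` with `‖u‖_p = 1`, GRANTED Cremona's fact (no Mazur / Abbes–Ullmo / Česnavičius input, any
  reduction type at `p`);
* `exists_periodUnit_two_of_cremona_of_goodSS` — on the habitat (`GoodSS W 2` ⇒ `E[2]` irreducible) with
  `N ≤ 130000`: the line's `stub_periodUnitAtTwo` AT `W` from Cremona's fact;
* `mu_eq_of_isPollackPair_two_of_cremona_of_not_two_dvd` / `…_of_cremona_of_supNorm_mazurTateElement_eq_one` —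
  PER (Cremona) + FLAT at `W` (resp. ONE even Mazur–Tate layer with a `2`-adic unit coefficient) ⇒ the analytic
  conjunct of Kμ⁺ at `W` (`μ(G) = m` for every admissible `(G, m)`): the per-class certificate of child 21437 on the
  153-class rung habitat (`N < 10⁴ ≤ 130000`) with BOTH inputs finite — a published modular-symbol computation
  (Cremona) and one layer of modular symbols;
* `forall_mu_eq_iff_not_two_dvd_of_cremona` — granted Cremona, for `N ≤ 130000` the bookkeeping at `W` is EXACTLY
  `2 ∤ L♭` (the AU-free reading `μ(L♭_f) = v₂(c₀)` of p580150 with `|c₀| = 1`).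
For the class-wide crux (all conductors) Abbes–Ullmo remains the print input; Cremona's range covers the rung.

References: A. Agashe, K. Ribet, W. Stein (appendix J. Cremona), Pure Appl. Math. Q. 2 (2006) Thm. 2.6, Thm. 5.2
[AgasheRibetStein2006]; R. Greenberg, V. Vatsal, Invent. Math. 142 (2000) §3 Rem. 3.4 [GreenbergVatsal2000];
R. Pollack, Duke Math. J. 118 (2003) Prop. 6.18 [Pollack2003].
-/

set_option autoImplicit false
set_option linter.dupNamespace false

noncomputable section

open scoped Classical MatrixGroups ModularForm

open CongruenceSubgroup WeierstrassCurve Literature.NumberTheory.EllipticCurves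
  Literature.NumberTheory.EllipticCurves.ModularForms Literature.NumberTheory.EllipticCurves.AgasheRibetStein2006
  Summit.BirchSwinnertonDyer.Rank1Residual.Supersingular Summit.BirchSwinnertonDyer.Rank1Residual.X1

namespace Summit.BirchSwinnertonDyer.BirchSwinnertonDyer.Theorems.SignedMuAtTwo

variable {W : WeierstrassCurve ℚ} [W.IsElliptic] [W.IsGloballyMinimal] {N : ℕ} [NeZero N]
  {f : CuspForm (Gamma0 N) 2}

/-- **The period unit from Cremona's `c₀ = 1`, ANY prime.** Granted the published computation
`cremona_abs_maninConstant_eq_one_of_level_le` (Manin constant `±1` for every optimal parametrisation datum at level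
`≤ 130000`), for `W/ℚ` globally minimal with `E[p]` irreducible and newform `f` at level `N ≤ 130000`:
`Ω(W) = u · Ω⁺_f` with `u ∈ ℚ`, `‖u‖_p = 1`. [cite: AgasheRibetStein2006, Thm. 2.6] [cite: GreenbergVatsal2000, §3, Remark 3.4] -/
theorem exists_periodUnit_of_cremona_of_level_le {p : ℕ} [Fact p.Prime]
    (hC : cremona_abs_maninConstant_eq_one_of_level_le) (hirr : W.HasIrreducibleModPGaloisRep p)
    (hf : IsNewformOf W f) (hN : N ≤ 130000) :
    ∃ u : ℚ, ‖(u : ℚ_[p])‖ = 1 ∧ W.realPeriodRat = u * plusPeriod f :=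
  exists_periodUnit_of_forall_optimal_not_dvd_maninConstant hirr hf
    fun W₀ _ _ D₀ _ hopt ↦ not_dvd_maninConstant_of_level_le hC W₀ D₀ hopt hN Fact.out

/-- **`stub_periodUnitAtTwo` AT `W` from Cremona** on the habitat (good supersingular at `2` ⇒ `E[2]` irreducible,
`P2.irr_two_of_goodSS_two`) for conductor/level `N ≤ 130000`. [cite: AgasheRibetStein2006, Thm. 2.6] -/
theorem exists_periodUnit_two_of_cremona_of_goodSS (hC : cremona_abs_maninConstant_eq_one_of_level_le)
    (hss : Rank1Residual.GoodSS W 2) (hf : IsNewformOf W f) (hN : N ≤ 130000) :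
    ∃ u : ℚ, ‖(u : ℚ_[2])‖ = 1 ∧ W.realPeriodRat = u * plusPeriod f :=
  exists_periodUnit_of_cremona_of_level_le hC (Rank1Residual.P2.irr_two_of_goodSS_two W hss) hf hN

omit [W.IsGloballyMinimal] in
/-- **Granted Cremona, for `N ≤ 130000` the analytic bookkeeping at `W` is EXACTLY `2 ∤ L♭`** (the period ratio is
a `2`-adic unit, so `μ(G) = m ⟺ μ(L♭) = 0`; the lead's `not_two_dvd_iff_mu_eq_of_isPollackPair_two_of_periodUnit`).
[cite: AgasheRibetStein2006, Thm. 2.6] [cite: Pollack2003, Prop. 6.18] -/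
theorem not_two_dvd_iff_mu_eq_of_cremona [W.IsGloballyMinimal] (hC : cremona_abs_maninConstant_eq_one_of_level_le)
    (hss : Rank1Residual.GoodSS W 2) (hf : IsNewformOf W f) (hN : N ≤ 130000) {ϖ : ℚ}
    (hϖ : (ϖ : ℝ) * W.realPeriodRat = plusPeriod f) {Lplus Lminus : IwasawaAlgebra 2}
    (hP : IsPollackPair f 2 Lplus Lminus) (G : IwasawaAlgebra 2) (m : ℕ)
    (hG : iwasawaToPowerSeries 2 G =
      PowerSeries.C ((2 : ℚ_[2]) ^ m * (ϖ : ℚ_[2])) * iwasawaToPowerSeries 2 (kobayashiL 1 Lplus Lminus)) :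
    ¬ PowerSeries.C (2 : ℤ_[2]) ∣ Lminus ↔ MuLambda.mu G = m :=
  not_two_dvd_iff_mu_eq_of_isPollackPair_two_of_periodUnit hϖ (exists_periodUnit_two_of_cremona_of_goodSS hC hss hf hN)
    hP G m hG

/-- **PER (Cremona) + FLAT at `W` ⇒ the analytic conjunct of Kμ⁺ at `W`** (`N ≤ 130000`).
[cite: AgasheRibetStein2006, Thm. 2.6] [cite: Pollack2003, Prop. 6.18] -/
theorem mu_eq_of_isPollackPair_two_of_cremona_of_not_two_dvd (hC : cremona_abs_maninConstant_eq_one_of_level_le)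
    (hss : Rank1Residual.GoodSS W 2) (hf : IsNewformOf W f) (hN : N ≤ 130000) {ϖ : ℚ}
    (hϖ : (ϖ : ℝ) * W.realPeriodRat = plusPeriod f) {Lplus Lminus : IwasawaAlgebra 2}
    (hμ : ¬ PowerSeries.C (2 : ℤ_[2]) ∣ Lminus) (G : IwasawaAlgebra 2) (m : ℕ)
    (hG : iwasawaToPowerSeries 2 G =
      PowerSeries.C ((2 : ℚ_[2]) ^ m * (ϖ : ℚ_[2])) * iwasawaToPowerSeries 2 (kobayashiL 1 Lplus Lminus)) :
    MuLambda.mu G = m :=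
  mu_eq_of_isPollackPair_two_of_periodUnit_of_not_two_dvd hϖ (exists_periodUnit_two_of_cremona_of_goodSS hC hss hf hN)
    hμ G m hG

/-- **THE RUNG'S PER-CLASS CERTIFICATE with both inputs finite: Cremona's `c₀ = 1` (`N ≤ 130000`) + ONE even
Mazur–Tate layer of `f` with a `2`-adic unit coefficient ⇒ the analytic conjunct of Kμ⁺ at `W`** (the layer gives
`μ(L♭) = 0` by the sibling crux's `mu_eq_zero_of_supNorm_mazurTateElement_two_eq_one`).
[cite: AgasheRibetStein2006, Thm. 2.6] [cite: Pollack2003, Prop. 6.18] [cite: PollackWeston2011MT, §3.1] -/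
theorem mu_eq_of_isPollackPair_two_of_cremona_of_supNorm_mazurTateElement_eq_one
    (hC : cremona_abs_maninConstant_eq_one_of_level_le)
    (hss : Rank1Residual.GoodSS W 2) (hf : IsNewformOf W f) (hN : N ≤ 130000) {ϖ : ℚ}
    (hϖ : (ϖ : ℝ) * W.realPeriodRat = plusPeriod f) {Lplus Lminus : IwasawaAlgebra 2}
    (hP : IsPollackPair f 2 Lplus Lminus) {n : ℕ} (hn : Even n)
    (h1 : ((mazurTateElement f 2 n).map (algebraMap ℚ (PadicAlgCl 2))).supNorm = 1)
    (G : IwasawaAlgebra 2) (m : ℕ)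
    (hG : iwasawaToPowerSeries 2 G =
      PowerSeries.C ((2 : ℚ_[2]) ^ m * (ϖ : ℚ_[2])) * iwasawaToPowerSeries 2 (kobayashiL 1 Lplus Lminus)) :
    MuLambda.mu G = m := by
  refine mu_eq_of_isPollackPair_two_of_cremona_of_not_two_dvd hC hss hf hN hϖ ?_ G m hG
  -- `μ(L♭) = 0` from the layer, then `2 ∤ L♭`
  have hμ0 : MuLambda.mu Lminus = 0 :=
    ResidualThetaLayer.mu_eq_zero_of_supNorm_mazurTateElement_two_eq_one f hP hn h1
  intro hdvd
  have h1' : PowerSeries.C ((2 : ℤ_[2]) ^ 1) ∣ Lminus := by rwa [pow_one]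
  have := MuLambda.le_mu_of_C_pow_dvd hP.2.1 h1'
  omega

omit [W.IsGloballyMinimal] in
/-- **The Manin reading under Cremona**: for `N ≤ 130000` the optimal datum of p580150 has `|c₀| = 1`, so the
AU-free reading «bookkeeping at `W` ⟺ `μ(L♭_f) = v₂(c₀)`» becomes «⟺ `μ(L♭_f) = 0`».
[cite: AgasheRibetStein2006, Thm. 2.6] [cite: GreenbergVatsal2000, §3, Remark 3.4] -/
theorem forall_mu_eq_iff_mu_eq_zero_of_cremona [W.IsGloballyMinimal]
    (hC : cremona_abs_maninConstant_eq_one_of_level_le)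
    (hss : Rank1Residual.GoodSS W 2) (hf : IsNewformOf W f) (hN : N ≤ 130000) {ϖ : ℚ}
    (hϖ : (ϖ : ℝ) * W.realPeriodRat = plusPeriod f) {Lplus Lminus : IwasawaAlgebra 2}
    (hP : IsPollackPair f 2 Lplus Lminus) :
    (∀ (G : IwasawaAlgebra 2) (m : ℕ), iwasawaToPowerSeries 2 G =
        PowerSeries.C ((2 : ℚ_[2]) ^ m * (ϖ : ℚ_[2])) * iwasawaToPowerSeries 2 (kobayashiL 1 Lplus Lminus) →
        MuLambda.mu G = m) ↔
      MuLambda.mu Lminus = 0 := by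
  obtain ⟨W₀, _, _, D₀, hf₀, hopt, hiff⟩ :=
    exists_optimalDatum_forall_mu_eq_iff_mu_eq_padicValInt_maninConstant_of_goodSS hss hf hϖ hP
  rw [hiff]
  -- `|c₀| = 1`, so `v₂(c₀) = 0`
  have habs : |D₀.maninConstant| = 1 := hC W₀ D₀ hopt hN
  have hc : D₀.c = 1 ∨ D₀.c = -1 := by
    rcases abs_eq (zero_le_one' ℤ) |>.mp habs with h | h
    · exact Or.inl h
    · exact Or.inr h
  have hv : padicValInt 2 D₀.c = 0 := by
    rcases hc with h | h <;> simp [h, padicValInt]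
  rw [hv]
  omega

end Summit.BirchSwinnertonDyer.BirchSwinnertonDyer.Theorems.SignedMuAtTwo

end
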